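import Summits.BirchSwinnertonDyer.Rank1Residual.O5.NonSplitAtThreeLawHolds
import Summits.BirchSwinnertonDyer.Rank1Residual.O5.NoLocalThreeTorsionTransport
import Summits.BirchSwinnertonDyer.Rank1Residual.O5.O5KummerLine
import Summits.BirchSwinnertonDyer.Rank1Residual.Additive.SelectorIdentityTameThreeProofs
import HarnessLib

/-!
# Kodaira `III*` at `3` ⟹ `NoLocalThreeTorsionAt W 3` (`W(ℚ₃)[3] = 0`) — UNCONDITIONALLY: the END
# binder `ht3` of the `HeegnerLogTransportThree` chain is a THEOREM on the `III*` stratum of (t′)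
# (cell `b2b-bsdres`, lane CLASS-CLOSURE, class O5; seat o5-r2 = O5 PLANNER 2, GEN 25)

HONEST FRAMING (cell `b2b-bsdres`, run/shared/lean/b2b/bsd-rank1-residual/, verbatim in every
file): the goal of the cell is to DELETE the COMBINATION-SHAPED residual classes of the
Birch–Swinnerton-Dyer formula for ALL analytic-rank `≤ 1` elliptic curves over `ℚ` — "full BSD
formula for every rank `≤ 1` curve in class `C`" assembled STRICTLY from published theorems — so
that the rank-`≤ 1` remainder becomes exactly the CONSTRUCTION-SHAPED classes, which are TYPED
(missing-input `Prop`s), NOT attempted. This is not "finishing BSD". Lane CLASS-CLOSURE: research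
routes; no claim beyond the stated classes; nothing is booked here; no mark of `RESIDUAL-MAP.md`
moves; census numbers are EVIDENCE. THEOREMS ONLY (no definition, no named fact, no conjecture node;
net named-fact debt `0`); no node file is touched; O5 stays OPEN.

## What this file proves

The conditional ENDs of the `HeegnerLogTransportThree` chain
(`O5/HeegnerLogTransportThreeStepZeroEndAnyDiscr.lean`, `o5_index_unit_of_ordinary_companion_cited_s0f`,
and its predecessors `_cited_s0e`, `_s0e_iso`, …) display the binder
`ht3 : NoLocalThreeTorsionAt W 3` — "no `ℚ₃`-root `x₀` of `Ψ₃` with `Ψ₂²(x₀)` a square in `ℚ₃`",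
i.e. `W(ℚ₃)[3] = 0` (`O5/NoLocalThreeTorsionTransport.lean` §1). Every END-eligible row of the
cell (t′) at `3` (a good-ORDINARY congruent companion forces the ramified stable line, o5-r2 GEN 25
census `U0`: `354 / 354` rank-`1` rows, all of Kodaira type `III*`) sits on the `III*` stratum
(`v₃(Δ) = 9`). Here that binder is DISCHARGED by a theorem, with no companion and no certificate:

* §1 (valued-field algebra, any valued field `(F, w)` with `3 = ϖ` a uniformiser)
  `NonSplitAtThree.map_Ψ₂Sq_eq_one_of_shapeIII` — on the type-III shape `b₂, b₄, b₆ ∈ ϖ𝒪` and a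
  unit `r`: `w (4r³ + b₂r² + 2b₄r + b₆) = 1` (`4 = 1 + 3` is a unit, the other three terms lie in
  `ϖ𝒪`); `NonSplitAtThree.sq_ne_exp_neg_three` — no element of `ℤᵐ⁰` squares to `exp (−3)`.
* §2 (polynomial algebra, any commutative ring) `NonSplitAtThree.eval_Ψ₂Sq_variableChange` —
  `Ψ₂²` along a change of variables `(u, r, s, t)`: `Ψ₂Sq'(u⁻²(y − r)) = u⁻⁶ · Ψ₂Sq(y)` (Mathlib's
  `variableChange_b₂/b₄/b₆`; companion of the tree's `eval_Ψ₃_variableChange`).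
* §3 (the completion `K_v`, `3` a uniformiser) `NonSplitAtThree.eval_Ψ₂Sq_ne_sq_of_shapeIIIstar` —
  on Tate's Step-9 normal form of type `III*` (`b₂ = π²β₂`, `b₄ = π³β₄`, `b₆ = π⁵β₆`, `Δ = π⁹δ`,
  `δ ∈ 𝒪^×`, `π = 3`): for every `K_v`-root `z` of `Ψ₃`, `Ψ₂²(z)` is NOT a square in `K_v`. Proof:
  the weight rescaling `bᵢ ↦ bᵢ/π^{i/2}`, `z ↦ r = z/π` lands on the type-III shape, where every
  root of `Ψ₃♭` is a unit (tree `NonSplitAtThree.map_root_eq_one_of_shapeIII`, after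
  `map_b₈_of_shapeIII`); then `Ψ₂²(z) = π³ · (4r³ + b₂♭r² + 2b₄♭r + b₆♭)` has valuation
  `exp (−3)` (§1), an odd exponent.
* §4 (curves over `ℚ`) **`noLocalThreeTorsionAt_three_of_kodairaSymbolAt_IIIstar`**: for every
  elliptic `W/ℚ` with `W.kodairaSymbolAt (placeOf 3) = .IIIstar`, `NoLocalThreeTorsionAt W 3`
  (Tate's Step-9 normal form over `ℚ_{(3)}`, Literature
  `exists_variableChange_b_of_kodairaSymbolAt_eq_IIIstar`; transport to Mathlib's `ℚ_[3]` along
  `Padic.adicCompletionEquiv`, exactly as in `O5/NonSplitAtThreeLawHolds.lean` §4); the point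
  reading `forall_three_nsmul_eq_zero_of_kodairaSymbolAt_IIIstar` (`W(ℚ₃)[3] = 0`, via E111's
  `noLocalThreeTorsionAt_iff_forall_three_nsmul`); the census spellings
  `kodairaSymbolAt_eq_IIIstar_of_subTprime_of_padicValRat_Δ_eq_nine` /
  `noLocalThreeTorsionAt_three_of_subTprime_of_padicValRat_Δ_eq_nine` (globally minimal `W`,
  `Addv W 3`, `SubTprime W 3`, `v₃(Δ) = 9`: the `III*` half of (t′), Ogg `ord Δ = m + 1`); and the
  companion reading `noLocalThreeTorsionAt_three_companion_of_kodairaSymbolAt_IIIstar` (a mod-3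
  congruent globally minimal `G` with `W[3]` irreducible also has `G(ℚ₃)[3] = 0`, E111 §2).

Contrast (EVIDENCE, o5-r2 GEN 25 census, not used here): on the type-`III` stratum (`v₃(Δ) = 3`) the
unique `ℚ₃`-root of `Ψ₃` IS a unit and `Ψ₂²` there is a `3`-adic unit, a square or not according to
its residue — `NoLocalThreeTorsionAt W 3` genuinely varies there; the theorem is specific to `III*`.

Nothing about any particular curve is asserted; no node is discharged here; no END binder is edited
in place (the `III*`-keyed END corollary is a separate leaf); census numbers stay EVIDENCE.

References: J. H. Silverman, *Advanced Topics in the Arithmetic of Elliptic Curves* (1994), IV.9.4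
Steps 4 and 9, Table 4.1 [SilvermanATAEC1994]; J. H. Silverman, *The Arithmetic of Elliptic Curves*,
2nd ed. (2009), III.2.3 (d), Exercise 3.7 [SilvermanAEC2009]; cell: `O5/NonSplitAtThreeLocal.lean`,
`O5/NonSplitAtThreeLawHolds.lean` (x11b3-p7), `O5/NoLocalThreeTorsionTransport.lean` (harvest-2 E111),
`O5/O5KummerLine.lean` §1 (the predicate), HOME/b2b-bsdres-o5-r2/gen25/O5-GEN25.md (census `U0`).

## Design

No definitions; `noncomputable section`; `open scoped Classical`. Axioms: `propext`,
`Classical.choice`, `Quot.sound`.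

## TYPER PLACEMENT NOTE (cc-typer-5 GEN 20 = O5 §3.5 / O6 §3.4 typer of record; by-name ask A-O5-G25-1 of o5-r2 GEN 25, HOME/INBOX.md l.14643:
'(a) NEW leaf `O5/NoLocalThreeTorsionIIIstar.lean` 2a73e90dd64f5997 THEN (b) NEW leaf `O5/HeegnerLogTransportThreeStepZeroEndIIIstar.lean` 399b945a73c1b077 — by sha,
byte-identical + your ¶, or not at all'; harvest-2 GEN 60 l.14659 / l.14661: '(a) and (b) are YOURS — harvest-2 does NOT file them'; memo `HOME/b2b-bsdres-o5-r2/gen25/O5-GEN25.md`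
b7e09027186a970a; order of record (a) → (b), after this seat's A-O5-G24-1 parts 20 p356385 / 20b p356989 / 21 p357273)

Source: `HOME/b2b-bsdres-o5-r2/gen25/lean/NoLocalThreeTorsionIIIstar.lean` sha16 `2a73e90dd64f5997` (362 l.; `gen25/SHA16.txt`; o5-r2's checks: farm rc 0 / 0 warn / 0 sorry, `#print axioms
noLocalThreeTorsionAt_three_of_kodairaSymbolAt_IIIstar` + `…_companion_…` standard; dedup of the new names none), re-hashed by the typer right before writing; THIS file =
the source VERBATIM + this paragraph (imports, module text, every declaration block byte-identical; script `class-closure/typer-5/gen20/g25_place.py`, docstring anchor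
asserted); imports `O5.NonSplitAtThreeLawHolds` (x11b3-p7), `O5.NoLocalThreeTorsionTransport` (harvest-2 E111), `O5.O5KummerLine`, `Additive.SelectorIdentityTameThreeProofs`
— all in the tree; the typer's own standalone farm check (rc 0 / 0 warnings / 0 sorries; `#print axioms` of `noLocalThreeTorsionAt_three_of_kodairaSymbolAt_IIIstar`,
`kodairaSymbolAt_eq_IIIstar_of_subTprime_of_padicValRat_Δ_eq_nine`, `noLocalThreeTorsionAt_three_companion_of_kodairaSymbolAt_IIIstar` standard) and DEDUP (`lean search
--decl` on the 10 new names: no FQN match) precede the proposal. NEAREST EXISTING DECLARATION (recorded by the typer, NOT identical, no FQN clash):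
`O5.kodairaSymbolAt_eq_IIIstar_of_subTprime_of_padicValRat [Fact (Nat.Prime 3)] (h5 : ClassO5 E 3) (ht : SubTprime E 3) (h9 : padicValRat 3 E.Δ = 9)` of
`O5/SupersingularLocalClassUniqueThreeProofs.lean` (l.165) concludes the same `E.kodairaSymbolAt (placeOf 3) = .IIIstar` from the STRONGER class hypothesis `ClassO5 E 3`;
§4's `kodairaSymbolAt_eq_IIIstar_of_subTprime_of_padicValRat_Δ_eq_nine` below assumes only `Addv W 3` (same Ogg `ord Δ = m + 1` argument) — a generalisation under a
distinct name, placed verbatim as asked; pointer given on the bus.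
CONTENT LABELS (source, unchanged): THEOREMS ONLY (10: §1 `NonSplitAtThree.map_Ψ₂Sq_eq_one_of_shapeIII`, `NonSplitAtThree.sq_ne_exp_neg_three`; §2 `NonSplitAtThree.eval_Ψ₂Sq_eq`,
`NonSplitAtThree.eval_Ψ₂Sq_variableChange`; §3 `NonSplitAtThree.eval_Ψ₂Sq_ne_sq_of_shapeIIIstar`; §4 `noLocalThreeTorsionAt_three_of_kodairaSymbolAt_IIIstar`,
`forall_three_nsmul_eq_zero_of_kodairaSymbolAt_IIIstar`, `kodairaSymbolAt_eq_IIIstar_of_subTprime_of_padicValRat_Δ_eq_nine`,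
`noLocalThreeTorsionAt_three_of_subTprime_of_padicValRat_Δ_eq_nine`, `noLocalThreeTorsionAt_three_companion_of_kodairaSymbolAt_IIIstar`) — 0 `def`, 0 `@[conjecture]`,
0 Literature facts (net named-fact debt 0), no `sorry`; UNCONDITIONAL (no displayed fact binder); tree inputs BY NAME (Literature `exists_variableChange_b_of_kodairaSymbolAt_eq_IIIstar`,
`NonSplitAtThree.map_root_eq_one_of_shapeIII` / `map_b₈_of_shapeIII` / `map_three`, E111 `noLocalThreeTorsionAt_iff_forall_three_nsmul` / `noLocalThreeTorsionAt_of_isCongruentModThree`,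
`subTprime_three_iff_kodairaSymbolAt_III_or_IIIstar`, `eval_Ψ₃_variableChange`, Mathlib `Padic.adicCompletionEquiv`), nothing re-proved. It makes the END binder
`ht3 : NoLocalThreeTorsionAt W 3` a THEOREM on the `III*` stratum; no node's statement is edited; the (b) leaf `O5/HeegnerLogTransportThreeStepZeroEndIIIstar.lean` (part 23,
`_cited_s0g[_iso/_x3e/_x3eRev]`) consumes it by name.
HONEST FRAMING (cell `b2b-bsdres`): research route, lane CLASS-CLOSURE §3.5 O5; nothing asserted beyond the displayed binders, nothing booked, no mark /
label / count / tier of `RESIDUAL-MAP.md` moves; census numbers (the GEN 25 `U0` census: 354 / 354 END-eligible rank-1 rows are `III*`) = EVIDENCE, never a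
Literature fact; O5 OPEN.
-/

set_option autoImplicit false

noncomputable section

open scoped Classical

open Polynomial WeierstrassCurve IsDedekindDomain IsDedekindDomain.HeightOneSpectrum WithZero
  Rat.HeightOneSpectrum Literature.NumberTheory.EllipticCurves
  Literature.NumberTheory.EllipticCurves.Rank1Residual Literature.NumberTheory.DiophantineGeometry
  Summit.BirchSwinnertonDyer.Rank1Residual.Additive

namespace Summit.BirchSwinnertonDyer.Rank1Residual.O5

namespace NonSplitAtThree

/-! ## §1 Valued-field algebra: `Ψ₂² = 4x³ + b₂x² + 2b₄x + b₆` at a unit, on the type-III shape -/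

section Valued

variable {F : Type*} [Field F] (w : Valuation F ℤᵐ⁰) {ϖ : F}

/-- **On the type-III shape `b₂, b₄, b₆ ∈ ϖ𝒪`, `Ψ₂²` of a UNIT is a unit**:
`w (4r³ + b₂r² + 2b₄r + b₆) = 1` for `w r = 1` (`4 = 1 + 3` is a unit and dominates strictly).
[folklore] -/
theorem map_Ψ₂Sq_eq_one_of_shapeIII (h3 : (3 : F) = ϖ) (hϖ : w ϖ = exp (-1 : ℤ)) {b₂ b₄ b₆ : F}
    (hb₂ : w b₂ ≤ exp (-1 : ℤ)) (hb₄ : w b₄ ≤ exp (-1 : ℤ)) (hb₆ : w b₆ ≤ exp (-1 : ℤ)) {r : F}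
    (hr : w r = 1) : w (4 * r ^ 3 + b₂ * r ^ 2 + 2 * b₄ * r + b₆) = 1 := by
  have w3 := map_three w h3 hϖ
  have hlt1 : exp (-1 : ℤ) < (1 : ℤᵐ⁰) := by rw [← exp_zero, exp_lt_exp]; norm_num
  have w4 : w 4 = 1 := by
    rw [show (4 : F) = 1 + 3 by norm_num]
    exact Valuation.map_one_add_of_lt w (by rw [w3]; exact hlt1)
  have w2 : w 2 ≤ 1 := by
    rw [show (2 : F) = 3 - 1 by norm_num]
    exact Valuation.map_sub_le w (by rw [w3]; exact hlt1.le) (by rw [map_one])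
  have h1 : w (4 * r ^ 3) = 1 := by rw [map_mul, map_pow, w4, hr, one_pow, mul_one]
  have h2 : w (b₂ * r ^ 2) < 1 := by
    rw [map_mul, map_pow, hr, one_pow, mul_one]; exact lt_of_le_of_lt hb₂ hlt1
  have h3' : w (2 * b₄ * r) < 1 := by
    rw [map_mul, map_mul, hr, mul_one]
    calc w 2 * w b₄ ≤ 1 * exp (-1 : ℤ) := mul_le_mul' w2 hb₄
      _ < 1 := by rw [one_mul]; exact hlt1
  have h4 : w b₆ < 1 := lt_of_le_of_lt hb₆ hlt1
  have s1 : w (4 * r ^ 3 + b₂ * r ^ 2) = 1 := by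
    rw [Valuation.map_add_eq_of_lt_left w (by rw [h1]; exact h2), h1]
  have s2 : w (4 * r ^ 3 + b₂ * r ^ 2 + 2 * b₄ * r) = 1 := by
    rw [Valuation.map_add_eq_of_lt_left w (by rw [s1]; exact h3'), s1]
  rw [Valuation.map_add_eq_of_lt_left w (by rw [s2]; exact h4), s2]

omit w in
/-- **Odd exponents are not squares in `ℤᵐ⁰`**: `a² ≠ exp (−3)`. [folklore] -/
theorem sq_ne_exp_neg_three (a : ℤᵐ⁰) : a ^ 2 ≠ exp (-3 : ℤ) := by
  intro h
  rcases eq_or_ne a 0 with h0 | h0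
  · rw [h0, zero_pow two_ne_zero] at h
    exact exp_ne_zero h.symm
  · rw [← exp_log h0, ← exp_nsmul, exp_inj, nsmul_eq_mul] at h
    push_cast at h
    omega

end Valued

/-! ## §2 `Ψ₂²` along a change of variables -/

section Poly

variable {R : Type*} [CommRing R]

/-- `Ψ₂²(x) = 4x³ + b₂x² + 2b₄x + b₆` (Mathlib's `Ψ₂Sq`, evaluated).
[cite: SilvermanAEC2009, Exercise 3.7 (a)] -/
theorem eval_Ψ₂Sq_eq (X : WeierstrassCurve R) (x : R) :
    X.Ψ₂Sq.eval x = 4 * x ^ 3 + X.b₂ * x ^ 2 + 2 * X.b₄ * x + X.b₆ := by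
  simp only [WeierstrassCurve.Ψ₂Sq, eval_add, eval_mul, eval_pow, eval_C, eval_X]

/-- **`Ψ₂²` along a change of variables** `(u, r, s, t)`: `Ψ₂Sq'(u⁻²(y − r)) = u⁻⁶ · Ψ₂Sq(y)`
(Taylor shift by `r`, read on Mathlib's `variableChange_b₂ … b₆`; companion of the tree's
`eval_Ψ₃_variableChange`). [folklore] -/
theorem eval_Ψ₂Sq_variableChange (X : WeierstrassCurve R) (C : VariableChange R) (y : R) :
    (C • X).Ψ₂Sq.eval ((C.u⁻¹ : Rˣ) ^ 2 * (y - C.r)) = (C.u⁻¹ : Rˣ) ^ 6 * X.Ψ₂Sq.eval y := by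
  rw [eval_Ψ₂Sq_eq, eval_Ψ₂Sq_eq, variableChange_b₂, variableChange_b₄, variableChange_b₆]
  ring

end Poly

/-! ## §3 Curves over the completion `K_v` (`3` a uniformiser): `Ψ₂²` at a root of `Ψ₃`, type III* -/

section Completion

variable {A : Type*} [CommRing A] [IsDedekindDomain A] {K : Type*} [Field K] [Algebra A K]
  [IsFractionRing A K] (v : HeightOneSpectrum A)

/-- **Type III*: at every `K_v`-root of `Ψ₃`, `Ψ₂²` is NOT a square.** On a `K_v`-model with
`b₂ = π²β₂`, `b₄ = π³β₄`, `b₆ = π⁵β₆`, `Δ = π⁹δ` (Silverman *ATAEC* IV.9.4 Step 9 normal form,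
`βᵢ ∈ 𝒪_v`, `δ ∈ 𝒪_v^×`) and `π = 3` in `K_v`: the weight rescaling `bᵢ ↦ bᵢ/π^{i/2}`, `z ↦ z/π`
lands on the type-III shape, where every root of `Ψ₃♭` is a unit (`map_root_eq_one_of_shapeIII`);
hence `Ψ₂²(z) = π³ · (unit)` has the odd valuation `exp (−3)` and is not a square.
[cite: SilvermanATAEC1994, IV.9.4 Step 9 (normal form of type III*)] -/
theorem eval_Ψ₂Sq_ne_sq_of_shapeIIIstar {π : K} (hπ : v.valuation K π = exp (-1 : ℤ))
    (h3 : (π : v.adicCompletion K) = 3) (N : WeierstrassCurve (v.adicCompletion K))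
    (β₂ β₄ β₆ δ : v.adicCompletionIntegers K) (hδ : IsUnit δ)
    (hb₂ : N.b₂ = (π : v.adicCompletion K) ^ 2 * β₂)
    (hb₄ : N.b₄ = (π : v.adicCompletion K) ^ 3 * β₄)
    (hb₆ : N.b₆ = (π : v.adicCompletion K) ^ 5 * β₆)
    (hΔ : N.Δ = (π : v.adicCompletion K) ^ 9 * δ) (z t : v.adicCompletion K)
    (hz : N.Ψ₃.eval z = 0) : N.Ψ₂Sq.eval z ≠ t ^ 2 := by
  set w : Valuation (v.adicCompletion K) ℤᵐ⁰ := Valued.v with hw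
  set ϖ : v.adicCompletion K := (π : v.adicCompletion K) with hϖ
  have hπv : w ϖ = exp (-1 : ℤ) := by rw [hw, hϖ, valuedAdicCompletion_eq_valuation', hπ]
  have hϖ0 : ϖ ≠ 0 := by
    intro h0; rw [h0, map_zero] at hπv; exact exp_ne_zero hπv.symm
  have hint : ∀ β : v.adicCompletionIntegers K, w (β : v.adicCompletion K) ≤ 1 := fun β ↦ β.2
  have hunit : ∀ {β : v.adicCompletionIntegers K}, IsUnit β → w (β : v.adicCompletion K) = 1 :=
    fun hβ ↦ valued_coe_eq_one_of_isUnit v hβ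
  have h3' : (3 : v.adicCompletion K) = ϖ := h3.symm
  -- the rescaled invariants `b♭ᵢ = bᵢ / ϖ^{i/2}`
  set c₂ : v.adicCompletion K := N.b₂ / ϖ with hc₂
  set c₄ : v.adicCompletion K := N.b₄ / ϖ ^ 2 with hc₄
  set c₆ : v.adicCompletion K := N.b₆ / ϖ ^ 3 with hc₆
  set c₈ : v.adicCompletion K := N.b₈ / ϖ ^ 4 with hc₈
  have ec₂ : c₂ = ϖ * β₂ := by rw [hc₂, hb₂]; field_simp
  have ec₄ : c₄ = ϖ * β₄ := by rw [hc₄, hb₄]; field_simp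
  have ec₆ : c₆ = ϖ ^ 2 * β₆ := by rw [hc₆, hb₆]; field_simp
  have wc₂ : w c₂ ≤ exp (-1 : ℤ) := by
    rw [ec₂, map_mul, hπv]
    calc exp (-1 : ℤ) * w (β₂ : v.adicCompletion K) ≤ exp (-1 : ℤ) * 1 := mul_le_mul' le_rfl (hint β₂)
      _ = exp (-1 : ℤ) := mul_one _
  have wc₄ : w c₄ ≤ exp (-1 : ℤ) := by
    rw [ec₄, map_mul, hπv]
    calc exp (-1 : ℤ) * w (β₄ : v.adicCompletion K) ≤ exp (-1 : ℤ) * 1 := mul_le_mul' le_rfl (hint β₄)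
      _ = exp (-1 : ℤ) := mul_one _
  have wc₆ : w c₆ ≤ exp (-2 : ℤ) := by
    rw [ec₆, map_mul, map_pow, hπv, ← exp_nsmul]
    calc exp (2 • (-1 : ℤ)) * w (β₆ : v.adicCompletion K) ≤ exp (2 • (-1 : ℤ)) * 1 :=
        mul_le_mul' le_rfl (hint β₆)
      _ = exp (-2 : ℤ) := by simp
  have wc₆' : w c₆ ≤ exp (-1 : ℤ) := wc₆.trans (by rw [exp_le_exp]; norm_num)
  have hrel : 4 * c₈ = c₂ * c₆ - c₄ ^ 2 := by
    rw [hc₈, hc₂, hc₆, hc₄]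
    field_simp
    linear_combination N.b_relation
  have hΔflat : -c₂ ^ 2 * c₈ - 8 * c₄ ^ 3 - 27 * c₆ ^ 2 + 9 * c₂ * c₄ * c₆ = N.Δ / ϖ ^ 6 := by
    rw [hc₈, hc₂, hc₆, hc₄, show N.Δ = -N.b₂ ^ 2 * N.b₈ - 8 * N.b₄ ^ 3 - 27 * N.b₆ ^ 2 +
      9 * N.b₂ * N.b₄ * N.b₆ from rfl]
    field_simp
  have wΔ : w (-c₂ ^ 2 * c₈ - 8 * c₄ ^ 3 - 27 * c₆ ^ 2 + 9 * c₂ * c₄ * c₆) = exp (-3 : ℤ) := by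
    rw [hΔflat, map_div₀, hΔ, map_mul, map_pow, map_pow, hπv, hunit hδ, mul_one, ← exp_nsmul,
      ← exp_nsmul, ← exp_sub]
    simp
  have wc₈ : w c₈ = exp (-2 : ℤ) :=
    NonSplitAtThree.map_b₈_of_shapeIII w h3' hπv wc₂ wc₄ wc₆ hrel wΔ
  -- the rescaled root `r = z/ϖ` is a unit
  have hresc : 3 * (z / ϖ) ^ 4 + c₂ * (z / ϖ) ^ 3 + 3 * c₄ * (z / ϖ) ^ 2 + 3 * c₆ * (z / ϖ) + c₈ = 0 := by
    rw [WeierstrassCurve.eval_Ψ₃_eq] at hz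
    have h : 3 * (z / ϖ) ^ 4 + c₂ * (z / ϖ) ^ 3 + 3 * c₄ * (z / ϖ) ^ 2 + 3 * c₆ * (z / ϖ) + c₈ =
        (3 * z ^ 4 + N.b₂ * z ^ 3 + 3 * N.b₄ * z ^ 2 + 3 * N.b₆ * z + N.b₈) / ϖ ^ 4 := by
      rw [hc₈, hc₂, hc₆, hc₄]
      field_simp
    rw [h, hz, zero_div]
  have hr1 : w (z / ϖ) = 1 :=
    NonSplitAtThree.map_root_eq_one_of_shapeIII w h3' hπv wc₂ wc₄ wc₆' wc₈ hresc
  -- `Ψ₂²(z) = ϖ³ · Ψ₂²♭(z/ϖ)` has valuation `exp (−3)`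
  have hfac : N.Ψ₂Sq.eval z =
      ϖ ^ 3 * (4 * (z / ϖ) ^ 3 + c₂ * (z / ϖ) ^ 2 + 2 * c₄ * (z / ϖ) + c₆) := by
    rw [eval_Ψ₂Sq_eq, hc₂, hc₆, hc₄]
    field_simp
  have wval : w (N.Ψ₂Sq.eval z) = exp (-3 : ℤ) := by
    rw [hfac, map_mul, map_pow, hπv, map_Ψ₂Sq_eq_one_of_shapeIII w h3' hπv wc₂ wc₄ wc₆' hr1,
      mul_one, ← exp_nsmul]
    simp
  intro hsq
  have hne := sq_ne_exp_neg_three (w t)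
  rw [← map_pow, ← hsq, wval] at hne
  exact hne rfl

end Completion

end NonSplitAtThree

/-! ## §4 Curves over `ℚ`: Kodaira III* at `3` ⟹ `W(ℚ₃)[3] = 0` -/

section Curves

open NonSplitAtThree

variable (W : WeierstrassCurve ℚ) [W.IsElliptic]

/-- **Kodaira `III*` at `3` ⟹ `NoLocalThreeTorsionAt W 3`** — no `ℚ₃`-root `x₀` of `Ψ₃` has
`Ψ₂²(x₀)` a square in `ℚ₃`; UNCONDITIONAL, no class hypothesis, no companion, no certificate.
Tate's Step-9 normal form over `K_v = ℚ_{(3)}` (Literature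
`exists_variableChange_b_of_kodairaSymbolAt_eq_IIIstar`) feeds §3 after moving the root along the
change of variables (§2, tree `eval_Ψ₃_variableChange`); transport from Mathlib's `ℚ_[3]` to
`ℚ_{(3)}` along the `ℚ`-algebra isomorphism `Padic.adicCompletionEquiv`
(`Polynomial.aeval_algHom_apply`). Discharges the END binder `ht3 : NoLocalThreeTorsionAt W 3` of
`o5_index_unit_of_ordinary_companion_cited_s0f` on the `III*` stratum.
[cite: SilvermanATAEC1994, IV.9.4 Step 9 and Table 4.1 (PDF pp. 346, 365)] -/
theorem noLocalThreeTorsionAt_three_of_kodairaSymbolAt_IIIstar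
    (hT : W.kodairaSymbolAt (placeOf 3) = .IIIstar) : NoLocalThreeTorsionAt W 3 := by
  haveI : PerfectField (IsLocalRing.ResidueField ((placeOf 3).adicCompletionIntegers ℚ)) :=
    PerfectField.ofFinite
  have h2 : ringChar (ℤ ⧸ (placeOf 3).asIdeal) ≠ 2 := by rw [ringChar_int_quot_placeOf 3]; decide
  have hgen : natGenerator (placeOf 3) = 3 :=
    Literature.NumberTheory.EllipticCurves.Rat.natGenerator_primesEquiv_symm ⟨3, Nat.prime_three⟩
  have hπ : (placeOf 3).valuation ℚ (3 : ℚ) = exp (-1 : ℤ) := by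
    have h := valuation_natGenerator_int (placeOf 3)
    rwa [hgen, Nat.cast_ofNat] at h
  have h3 : algebraMap ℚ ((placeOf 3).adicCompletion ℚ) 3 = 3 := map_ofNat _ 3
  obtain ⟨C, β₂, β₄, β₆, δ, hδ, hb₂, hb₄, hb₆, hΔ⟩ :=
    W.exists_variableChange_b_of_kodairaSymbolAt_eq_IIIstar (placeOf 3) h2 hT hπ
  set Kv := (placeOf 3).adicCompletion ℚ
  let e : ℚ_[3] ≃ₐ[ℚ] Kv := (Padic.adicCompletionEquiv ℤ ⟨3, Nat.prime_three⟩).toAlgEquiv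
  intro x₀ s hx hs
  have hx' : (W.baseChange Kv).Ψ₃.eval (e x₀) = 0 := by
    rw [IsRoot.def, WeierstrassCurve.baseChange, map_Ψ₃, eval_map, ← aeval_def] at hx
    rw [WeierstrassCurve.baseChange, map_Ψ₃, eval_map, ← aeval_def, aeval_algHom_apply, hx, map_zero]
  have hs' : (W.baseChange Kv).Ψ₂Sq.eval (e x₀) = e s ^ 2 := by
    rw [WeierstrassCurve.baseChange, map_Ψ₂Sq, eval_map, ← aeval_def] at hs
    rw [WeierstrassCurve.baseChange, map_Ψ₂Sq, eval_map, ← aeval_def, aeval_algHom_apply, hs, map_pow]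
  have hz : (C • W.baseChange Kv).Ψ₃.eval ((C.u⁻¹ : Kvˣ) ^ 2 * (e x₀ - C.r)) = 0 := by
    rw [eval_Ψ₃_variableChange, hx', mul_zero]
  have hzs : (C • W.baseChange Kv).Ψ₂Sq.eval ((C.u⁻¹ : Kvˣ) ^ 2 * (e x₀ - C.r)) =
      ((C.u⁻¹ : Kvˣ) ^ 3 * e s) ^ 2 := by
    rw [eval_Ψ₂Sq_variableChange, hs']
    ring
  exact eval_Ψ₂Sq_ne_sq_of_shapeIIIstar (placeOf 3) hπ h3 _ β₂ β₄ β₆ δ hδ hb₂ hb₄ hb₆ hΔ _ _ hz hzs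

/-- **Kodaira `III*` at `3` ⟹ `W(ℚ₃)[3] = 0`**: every `ℚ₃`-point killed by `3` is `O` (the point
reading of `NoLocalThreeTorsionAt`, `O5/NoLocalThreeTorsionTransport.lean` §1).
[cite: SilvermanATAEC1994, IV.9.4 Step 9 (normal form of type III*)]
[cite: SilvermanAEC2009, Exercise 3.7 (d),(f)] -/
theorem forall_three_nsmul_eq_zero_of_kodairaSymbolAt_IIIstar
    (hT : W.kodairaSymbolAt (placeOf 3) = .IIIstar) :
    ∀ P : (W.baseChange ℚ_[3]).toAffine.Point, 3 • P = 0 → P = 0 :=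
  (noLocalThreeTorsionAt_iff_forall_three_nsmul W 3).mp
    (noLocalThreeTorsionAt_three_of_kodairaSymbolAt_IIIstar W hT)

/-- **The `III*` half of (t′) at `3`, in the census spelling**: for globally minimal `W`, additive at
`3`, in the cell (t′) (`SubTprime W 3` ⟺ Kodaira `III` or `III*`), `v₃(Δ) = 9` singles out `III*`
(Ogg's `ord₃ Δ_min = m + 1`: `III ↦ 3`, `III* ↦ 9`).
[cite: SilvermanATAEC1994, IV.9.4 Steps 4, 9 and Table 4.1 (PDF pp. 344–346, 365)] -/
theorem kodairaSymbolAt_eq_IIIstar_of_subTprime_of_padicValRat_Δ_eq_nine [W.IsGloballyMinimal]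
    (hadd : Addv W 3) (ht : SubTprime W 3) (h9 : padicValRat 3 W.Δ = 9) :
    W.kodairaSymbolAt (placeOf 3) = .IIIstar := by
  haveI : PerfectField (IsLocalRing.ResidueField ((placeOf 3).adicCompletionIntegers ℚ)) :=
    PerfectField.ofFinite
  have h2 : ringChar (ℤ ⧸ (placeOf 3).asIdeal) ≠ 2 := by rw [ringChar_int_quot_placeOf 3]; decide
  rcases (subTprime_three_iff_kodairaSymbolAt_III_or_IIIstar (W := W) hadd).mp ht with h | h
  · exfalso
    have hord := W.ordMinimalDiscriminant_eq_numComponentsAt_add_one_of_kodairaSymbolAt (placeOf 3)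
      h2 (Or.inl h)
    rw [ordMinimalDiscriminant_placeOf_eq W 3] at hord
    unfold numComponentsAt at hord
    rw [h] at hord
    simp only [KodairaSymbol.numComponents] at hord
    rw [padicValRat_Δ_eq_padicValInt_minimalDiscriminantInt W] at h9
    omega
  · exact h

/-- **(t′) with `v₃(Δ) = 9` ⟹ `NoLocalThreeTorsionAt W 3`** (the census spelling of the `III*`
stratum; `kodairaSymbolAt_eq_IIIstar_of_subTprime_of_padicValRat_Δ_eq_nine` +
`noLocalThreeTorsionAt_three_of_kodairaSymbolAt_IIIstar`).
[cite: SilvermanATAEC1994, IV.9.4 Step 9 and Table 4.1 (PDF pp. 346, 365)] -/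
theorem noLocalThreeTorsionAt_three_of_subTprime_of_padicValRat_Δ_eq_nine [W.IsGloballyMinimal]
    (hadd : Addv W 3) (ht : SubTprime W 3) (h9 : padicValRat 3 W.Δ = 9) :
    NoLocalThreeTorsionAt W 3 :=
  noLocalThreeTorsionAt_three_of_kodairaSymbolAt_IIIstar W
    (kodairaSymbolAt_eq_IIIstar_of_subTprime_of_padicValRat_Δ_eq_nine W hadd ht h9)

/-- **Companion reading**: for globally minimal elliptic `W, G/ℚ` with `W[3]` irreducible,
`IsCongruentModThree W G` and `W` of Kodaira type `III*` at `3`, ALSO `G(ℚ₃)[3] = 0`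
(`NoLocalThreeTorsionAt G 3`; E111's transport `noLocalThreeTorsionAt_iff_of_isCongruentModThree`).
For a good ORDINARY companion `G` this is the statement that the étale quotient character of
`G[3]|G_{ℚ₃}` is non-trivial or the extension is non-split; nothing is booked. [folklore] -/
theorem noLocalThreeTorsionAt_three_companion_of_kodairaSymbolAt_IIIstar [W.IsGloballyMinimal]
    (G : WeierstrassCurve ℚ) [G.IsElliptic] [G.IsGloballyMinimal]
    (hirr : W.HasIrreducibleModPGaloisRep 3) (hcong : IsCongruentModThree W G)
    (hT : W.kodairaSymbolAt (placeOf 3) = .IIIstar) : NoLocalThreeTorsionAt G 3 :=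
  noLocalThreeTorsionAt_of_isCongruentModThree W G hirr hcong 3
    (noLocalThreeTorsionAt_three_of_kodairaSymbolAt_IIIstar W hT)

end Curves

end Summit.BirchSwinnertonDyer.Rank1Residual.O5

end
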